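import Mathlib
import HarnessLib

/-!
# Stub `stub_sublevelSqrt` (B2) of line `Sketch`, crux `TwistAmplification.SomeWindowSaving`
# (stmt-ABC-1976): the square-root sublevel estimate for the normalized cubic

For the normalized Weierstrass cubic `p(s) = 4 s³ − G₂ s − G₃` with `|G₂| ≤ 1`, `|G₃| ≤ 1` and
`|G₂| = 1 ∨ |G₃| = 1`, and every `0 < η ≤ 1/4`, the Lebesgue measure of the thin sublevel slice
`T = {s ∈ [−2, 2] : 0 < p(s) < η}` is at most `6 √η` (uniformly in `G₂, G₃`, double roots allowed).

The proof is root-free and derivative-free.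

* **Key lemma** (`SublevelSqrt.sq_halfWidth_le`): if a whole interval `[m − h, m + h]` lies in
  `{0 < p < η}` then `h² ≤ η`.  Only the exact finite differences
  `p(m+h) − p(m−h) = 2h(12m² − G₂) + 8h³` and `p(m+h) + p(m−h) − 2p(m) = 24 m h²` are used:
  for `|m| ≥ 1/10` the second one gives `2.4 h² ≤ 24|m|h² < 2η`; for `|m| < 1/10` the
  normalization leaves three cases — `|G₃| = 1` is impossible (`|p(m)| ≥ 0.896 > η`),
  `G₂ = −1` gives `2h ≤ p(m+h) − p(m−h) < η`, and `G₂ = 1` gives first `h ≤ 1/5` (the difference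
  at step `1/5` would be `< −0.288 < −η`) and then `1.44 h < η`.
* **Monotonicity pieces**: `ℝ` is covered by `J₁ = {s ≤ 0, 12s² ≥ G₂}`, `J₂ = {12 s² ≤ G₂}`,
  `J₃ = {s ≥ 0, 12 s² ≥ G₂}`; on `J₁, J₃` the cubic is monotone and on `J₂` antitone (two-point
  versions, by factoring `p(y) − p(x)`), so two points `a ≤ b` of `T ∩ Jᵢ` span an interval
  `[a, b] ⊆ {0 < p < η}`, whence `b − a ≤ 2√η`, `volume (T ∩ Jᵢ) ≤ diam ≤ 2√η`
  (`Real.volume_le_diam`) and `volume T ≤ 3 · 2√η`.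
-/

-- `Summit.<Summit>.<Problem>` is the mandated summit-side namespace (CONVENTIONS §2); for the
-- single-conjunct summit `ABC` the two coincide, so the duplicate `ABC.ABC` is deliberate.
set_option linter.dupNamespace false

noncomputable section

open MeasureTheory

namespace Summit.ABC.ABC.Theorems

namespace SublevelSqrt

/-- **Key finite-difference lemma.** If `[m − h, m + h] ⊆ {0 < 4s³ − G₂s − G₃ < η}` with
`η ≤ 1/4`, `|G₂| ≤ 1` and `|G₂| = 1 ∨ |G₃| = 1`, then `h² ≤ η`. -/
theorem sq_halfWidth_le {G₂ G₃ η m h : ℝ} (hG₂ : |G₂| ≤ 1) (hG : |G₂| = 1 ∨ |G₃| = 1)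
    (hη₀ : η ≤ 1 / 4) (hh : 0 ≤ h)
    (hT : ∀ x, m - h ≤ x → x ≤ m + h →
      0 < 4 * x ^ 3 - G₂ * x - G₃ ∧ 4 * x ^ 3 - G₂ * x - G₃ < η) :
    h ^ 2 ≤ η := by
  obtain ⟨h0l, h0u⟩ := hT m (by linarith) (by linarith)
  obtain ⟨h1l, h1u⟩ := hT (m + h) (by linarith) le_rfl
  obtain ⟨h2l, h2u⟩ := hT (m - h) le_rfl (by linarith)
  have hη : 0 < η := h0l.trans h0u
  -- the two exact finite differences of the cubic
  have I1 : (4 * (m + h) ^ 3 - G₂ * (m + h) - G₃) - (4 * (m - h) ^ 3 - G₂ * (m - h) - G₃) =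
      2 * h * (12 * m ^ 2 - G₂) + 8 * h ^ 3 := by ring
  have I2 : (4 * (m + h) ^ 3 - G₂ * (m + h) - G₃) + (4 * (m - h) ^ 3 - G₂ * (m - h) - G₃) -
      2 * (4 * m ^ 3 - G₂ * m - G₃) = 24 * m * h ^ 2 := by ring
  have hI1u : 2 * h * (12 * m ^ 2 - G₂) + 8 * h ^ 3 < η := by linarith
  have hI1l : -η < 2 * h * (12 * m ^ 2 - G₂) + 8 * h ^ 3 := by linarith
  have hI2u : 24 * m * h ^ 2 < 2 * η := by linarith
  have hI2l : -(2 * η) < 24 * m * h ^ 2 := by linarith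
  rcases le_or_gt (1 / 10) m with hm | hm
  · -- (a+) `2.4 h² ≤ 24 m h² < 2η`
    nlinarith [mul_nonneg (sub_nonneg.2 hm) (sq_nonneg h)]
  rcases le_or_gt m (-1 / 10) with hm' | hm'
  · -- (a-) `2.4 h² ≤ -24 m h² < 2η`
    nlinarith [mul_nonneg (by linarith : (0 : ℝ) ≤ -1 / 10 - m) (sq_nonneg h)]
  -- from now on `|m| < 1/10`
  have hmabs : |m| < 1 / 10 := abs_lt.2 ⟨by linarith, hm⟩
  have hm2 : m ^ 2 < 1 / 100 := by nlinarith
  rcases hG with hG2 | hG3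
  · rcases (abs_eq zero_le_one).1 hG2 with rfl | rfl
    · -- (d) `G₂ = 1`: first `h ≤ 1/5`, then `1.44 h < η`
      have hh5 : h ≤ 1 / 5 := by
        by_contra H
        have H : 1 / 5 < h := not_le.1 H
        obtain ⟨h3l, -⟩ := hT (m + 1 / 5) (by linarith) (by linarith)
        obtain ⟨-, h4u⟩ := hT (m - 1 / 5) (by linarith) (by linarith)
        have I3 : (4 * (m + 1 / 5) ^ 3 - 1 * (m + 1 / 5) - G₃) -
            (4 * (m - 1 / 5) ^ 3 - 1 * (m - 1 / 5) - G₃) = 24 / 5 * m ^ 2 - 42 / 125 := by ring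
        linarith
      have e1 : h * m ^ 2 ≤ h * (1 / 100) := mul_le_mul_of_nonneg_left hm2.le hh
      have e2 : h ^ 2 ≤ 1 / 25 := by
        nlinarith [mul_nonneg (sub_nonneg.2 hh5) (by linarith : (0 : ℝ) ≤ 1 / 5 + h)]
      have e3 : h ^ 3 ≤ h * (1 / 25) := by nlinarith [mul_nonneg hh (sub_nonneg.2 e2)]
      have h6 : h < η := by nlinarith
      nlinarith [mul_nonneg hh (sub_nonneg.2 h6.le), mul_nonneg hη.le (sub_nonneg.2 h6.le),
        mul_nonneg hη.le (sub_nonneg.2 hη₀)]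
    · -- (c) `G₂ = -1`: `2h ≤ p(m+h) - p(m-h) < η`
      have h6 : 2 * h < η := by nlinarith [mul_nonneg hh (sq_nonneg m), pow_nonneg hh 3]
      nlinarith [mul_nonneg hh (sub_nonneg.2 h6.le), mul_nonneg hη.le (sub_nonneg.2 h6.le),
        mul_nonneg hη.le (sub_nonneg.2 hη₀)]
  · -- (b) `|G₃| = 1` is incompatible with `|m| < 1/10` and `0 < p(m) < η ≤ 1/4`
    exfalso
    have hGm : |G₂ * m| ≤ 1 * (1 / 10) := by
      rw [abs_mul]; exact mul_le_mul hG₂ hmabs.le (abs_nonneg m) zero_le_one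
    have hm3 : |m ^ 3| < (1 / 10) ^ 3 := by
      rw [abs_pow]; exact pow_lt_pow_left₀ hmabs (abs_nonneg m) (by norm_num)
    obtain ⟨hGm₁, hGm₂⟩ := abs_le.1 hGm
    obtain ⟨hm3₁, hm3₂⟩ := abs_lt.1 hm3
    rcases (abs_eq zero_le_one).1 hG3 with rfl | rfl
    · linarith
    · linarith

/-- From the key lemma: an interval `[a, b] ⊆ {0 < 4s³ − G₂s − G₃ < η}` has length `≤ 2√η`. -/
theorem width_le {G₂ G₃ η a b : ℝ} (hG₂ : |G₂| ≤ 1) (hG : |G₂| = 1 ∨ |G₃| = 1)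
    (hη₀ : η ≤ 1 / 4) (hab : a ≤ b)
    (hT : ∀ x, a ≤ x → x ≤ b → 0 < 4 * x ^ 3 - G₂ * x - G₃ ∧ 4 * x ^ 3 - G₂ * x - G₃ < η) :
    b - a ≤ 2 * Real.sqrt η := by
  have key := sq_halfWidth_le (m := (a + b) / 2) (h := (b - a) / 2) hG₂ hG hη₀ (by linarith)
    (fun x hx₁ hx₂ => hT x (by linarith) (by linarith))
  have := Real.le_sqrt_of_sq_le key
  linarith

/-- Two-point monotonicity of the cubic on `{s ≥ 0, 12 s² ≥ G₂}` (and to the right of it). -/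
theorem mono_right {G₂ G₃ x y : ℝ} (hx : 0 ≤ x) (hxy : x ≤ y) (hG : G₂ ≤ 12 * x ^ 2) :
    4 * x ^ 3 - G₂ * x - G₃ ≤ 4 * y ^ 3 - G₂ * y - G₃ := by
  nlinarith [mul_nonneg (sub_nonneg.2 hxy) (sub_nonneg.2 hG),
    mul_nonneg (mul_self_nonneg (y - x)) (by linarith : 0 ≤ y + 2 * x)]

/-- Two-point monotonicity of the cubic on `{s ≤ 0, 12 s² ≥ G₂}` (and to the left of it). -/
theorem mono_left {G₂ G₃ x y : ℝ} (hy : y ≤ 0) (hxy : x ≤ y) (hG : G₂ ≤ 12 * y ^ 2) :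
    4 * x ^ 3 - G₂ * x - G₃ ≤ 4 * y ^ 3 - G₂ * y - G₃ := by
  nlinarith [mul_nonneg (sub_nonneg.2 hxy) (sub_nonneg.2 hG),
    mul_nonneg (mul_self_nonneg (y - x)) (by linarith : 0 ≤ -x - 2 * y)]

/-- Two-point antitonicity of the cubic on the critical strip `{12 s² ≤ G₂}`. -/
theorem anti_mid {G₂ G₃ x y : ℝ} (hxy : x ≤ y) (hx : 12 * x ^ 2 ≤ G₂) (hy : 12 * y ^ 2 ≤ G₂) :
    4 * y ^ 3 - G₂ * y - G₃ ≤ 4 * x ^ 3 - G₂ * x - G₃ := by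
  nlinarith [mul_nonneg (sub_nonneg.2 hxy) (sub_nonneg.2 hx),
    mul_nonneg (sub_nonneg.2 hxy) (sub_nonneg.2 hy), pow_nonneg (sub_nonneg.2 hxy) 3]

/-- A set of reals any two points of which are within `d` of each other has measure `≤ d`
(`volume ≤ diam`). -/
theorem volume_le_of_forall_sub_le {S : Set ℝ} {d : ℝ}
    (h : ∀ a ∈ S, ∀ b ∈ S, a ≤ b → b - a ≤ d) : volume S ≤ ENNReal.ofReal d := by
  refine (Real.volume_le_diam S).trans (Metric.ediam_le fun x hx y hy => ?_)
  rw [edist_dist, Real.dist_eq]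
  refine ENNReal.ofReal_le_ofReal ?_
  rcases le_total x y with hxy | hxy
  · rw [abs_sub_comm, abs_of_nonneg (sub_nonneg.2 hxy)]
    exact h x hx y hy hxy
  · rw [abs_of_nonneg (sub_nonneg.2 hxy)]
    exact h y hy x hx hxy

/-- Piece `J₁ = {s ≤ 0, 12 s² ≥ G₂}`: the slice meets it in a set of measure `≤ 2√η`. -/
theorem volume_piece_left {G₂ G₃ η : ℝ} (hG₂ : |G₂| ≤ 1) (hG : |G₂| = 1 ∨ |G₃| = 1)
    (hη₀ : η ≤ 1 / 4) :
    volume ({s : ℝ | 0 < 4 * s ^ 3 - G₂ * s - G₃ ∧ 4 * s ^ 3 - G₂ * s - G₃ < η} ∩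
      {s | s ≤ 0 ∧ G₂ ≤ 12 * s ^ 2}) ≤ ENNReal.ofReal (2 * Real.sqrt η) := by
  refine volume_le_of_forall_sub_le fun a ha b hb hab => width_le hG₂ hG hη₀ hab ?_
  simp only [Set.mem_inter_iff, Set.mem_setOf_eq] at ha hb
  obtain ⟨⟨ha0, -⟩, -, -⟩ := ha
  obtain ⟨⟨-, hbη⟩, hb₀, hb₂⟩ := hb
  intro x hax hxb
  have hx₀ : x ≤ 0 := hxb.trans hb₀
  have hx₂ : G₂ ≤ 12 * x ^ 2 := by
    nlinarith [mul_nonneg_of_nonpos_of_nonpos (by linarith : x + b ≤ 0) (sub_nonpos.2 hxb)]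
  exact ⟨ha0.trans_le (mono_left hx₀ hax hx₂), (mono_left hb₀ hxb hb₂).trans_lt hbη⟩

/-- Piece `J₂ = {12 s² ≤ G₂}`: the slice meets it in a set of measure `≤ 2√η`. -/
theorem volume_piece_mid {G₂ G₃ η : ℝ} (hG₂ : |G₂| ≤ 1) (hG : |G₂| = 1 ∨ |G₃| = 1)
    (hη₀ : η ≤ 1 / 4) :
    volume ({s : ℝ | 0 < 4 * s ^ 3 - G₂ * s - G₃ ∧ 4 * s ^ 3 - G₂ * s - G₃ < η} ∩
      {s | 12 * s ^ 2 ≤ G₂}) ≤ ENNReal.ofReal (2 * Real.sqrt η) := by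
  refine volume_le_of_forall_sub_le fun a ha b hb hab => width_le hG₂ hG hη₀ hab ?_
  simp only [Set.mem_inter_iff, Set.mem_setOf_eq] at ha hb
  obtain ⟨⟨-, haη⟩, ha₂⟩ := ha
  obtain ⟨⟨hb0, -⟩, hb₂⟩ := hb
  intro x hax hxb
  have hx₂ : 12 * x ^ 2 ≤ G₂ := by
    rcases le_total 0 x with h₀ | h₀
    · nlinarith [mul_nonneg (add_nonneg h₀ (h₀.trans hxb)) (sub_nonneg.2 hxb)]
    · nlinarith [mul_nonneg_of_nonpos_of_nonpos (add_nonpos (hax.trans h₀) h₀) (sub_nonpos.2 hax)]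
  exact ⟨hb0.trans_le (anti_mid hxb hx₂ hb₂), (anti_mid hax ha₂ hx₂).trans_lt haη⟩

/-- Piece `J₃ = {s ≥ 0, 12 s² ≥ G₂}`: the slice meets it in a set of measure `≤ 2√η`. -/
theorem volume_piece_right {G₂ G₃ η : ℝ} (hG₂ : |G₂| ≤ 1) (hG : |G₂| = 1 ∨ |G₃| = 1)
    (hη₀ : η ≤ 1 / 4) :
    volume ({s : ℝ | 0 < 4 * s ^ 3 - G₂ * s - G₃ ∧ 4 * s ^ 3 - G₂ * s - G₃ < η} ∩
      {s | 0 ≤ s ∧ G₂ ≤ 12 * s ^ 2}) ≤ ENNReal.ofReal (2 * Real.sqrt η) := by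
  refine volume_le_of_forall_sub_le fun a ha b hb hab => width_le hG₂ hG hη₀ hab ?_
  simp only [Set.mem_inter_iff, Set.mem_setOf_eq] at ha hb
  obtain ⟨⟨ha0, -⟩, ha₀, ha₂⟩ := ha
  obtain ⟨⟨-, hbη⟩, -, -⟩ := hb
  intro x hax hxb
  have hx₀ : 0 ≤ x := ha₀.trans hax
  have hx₂ : G₂ ≤ 12 * x ^ 2 := by
    nlinarith [mul_nonneg (add_nonneg ha₀ hx₀) (sub_nonneg.2 hax)]
  exact ⟨ha0.trans_le (mono_right ha₀ hax ha₂), (mono_right hx₀ hxb hx₂).trans_lt hbη⟩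

/-- Subadditivity of Lebesgue measure over three pieces. -/
theorem measure_union₃_le (A B C : Set ℝ) :
    volume (A ∪ B ∪ C) ≤ volume A + volume B + volume C :=
  le_trans (measure_union_le _ _) (add_le_add (measure_union_le _ _) le_rfl)

end SublevelSqrt

open SublevelSqrt in
/-- **Stub B2 (`SublevelSqrt`), the square-root sublevel estimate.** There are `η₀ > 0` and
`C₂ > 0` (namely `η₀ = 1/4`, `C₂ = 6`) such that for the normalized cubic
`p(s) = 4s³ − G₂ s − G₃` with `|G₂| ≤ 1`, `|G₃| ≤ 1`, `|G₂| = 1 ∨ |G₃| = 1` and every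
`0 < η ≤ η₀`, the Lebesgue measure of `{s ∈ [−2, 2] : 0 < p(s) < η}` is `≤ C₂ √η`.
Root-free proof: cover by the three monotonicity pieces `{s ≤ 0, 12s² ≥ G₂}`, `{12s² ≤ G₂}`,
`{s ≥ 0, 12s² ≥ G₂}` of the cubic; on each, two points of the slice span an interval inside
`{0 < p < η}`, which has length `≤ 2√η` by the finite-difference lemma
`SublevelSqrt.sq_halfWidth_le`; conclude with `volume ≤ diam`. -/
theorem stub_sublevelSqrt :
    ∃ η₀ C₂ : ℝ, 0 < η₀ ∧ 0 < C₂ ∧ ∀ G₂ G₃ η : ℝ, |G₂| ≤ 1 → |G₃| ≤ 1 → (|G₂| = 1 ∨ |G₃| = 1) →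
      0 < η → η ≤ η₀ →
        volume {s : ℝ | s ∈ Set.Icc (-2 : ℝ) 2 ∧ 0 < 4 * s ^ 3 - G₂ * s - G₃ ∧
            4 * s ^ 3 - G₂ * s - G₃ < η} ≤ ENNReal.ofReal (C₂ * Real.sqrt η) := by
  refine ⟨1 / 4, 6, by norm_num, by norm_num, ?_⟩
  intro G₂ G₃ η hG₂ _hG₃ hG _hη hη₀
  -- drop the constraint `s ∈ [-2, 2]` and cover by the three monotonicity pieces
  have hcover : {s : ℝ | s ∈ Set.Icc (-2 : ℝ) 2 ∧ 0 < 4 * s ^ 3 - G₂ * s - G₃ ∧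
      4 * s ^ 3 - G₂ * s - G₃ < η} ⊆
      ({s : ℝ | 0 < 4 * s ^ 3 - G₂ * s - G₃ ∧ 4 * s ^ 3 - G₂ * s - G₃ < η} ∩
          {s | s ≤ 0 ∧ G₂ ≤ 12 * s ^ 2} ∪
        {s : ℝ | 0 < 4 * s ^ 3 - G₂ * s - G₃ ∧ 4 * s ^ 3 - G₂ * s - G₃ < η} ∩
          {s | 12 * s ^ 2 ≤ G₂}) ∪
        {s : ℝ | 0 < 4 * s ^ 3 - G₂ * s - G₃ ∧ 4 * s ^ 3 - G₂ * s - G₃ < η} ∩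
          {s | 0 ≤ s ∧ G₂ ≤ 12 * s ^ 2} := by
    rintro s ⟨-, hs⟩
    simp only [Set.mem_union, Set.mem_inter_iff, Set.mem_setOf_eq]
    rcases le_total (12 * s ^ 2) G₂ with h₂ | h₂
    · exact Or.inl (Or.inr ⟨hs, h₂⟩)
    rcases le_total s 0 with h₀ | h₀
    · exact Or.inl (Or.inl ⟨hs, h₀, h₂⟩)
    · exact Or.inr ⟨hs, h₀, h₂⟩
  have h2η : 0 ≤ 2 * Real.sqrt η := by positivity
  have h6 : ENNReal.ofReal (6 * Real.sqrt η) = ENNReal.ofReal (2 * Real.sqrt η) +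
      ENNReal.ofReal (2 * Real.sqrt η) + ENNReal.ofReal (2 * Real.sqrt η) := by
    rw [← ENNReal.ofReal_add h2η h2η, ← ENNReal.ofReal_add (by positivity) h2η]
    congr 1
    ring
  rw [h6]
  exact le_trans (measure_mono hcover) (le_trans (measure_union₃_le _ _ _)
    (add_le_add (add_le_add (volume_piece_left hG₂ hG hη₀) (volume_piece_mid hG₂ hG hη₀))
      (volume_piece_right hG₂ hG hη₀)))

end Summit.ABC.ABC.Theorems

end
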